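import Literature.Topology.PlaneTopology.WindingNumber
import HarnessLib

/-!
# N1 ▸ `node_N1_move` ▸ (d) N1-mono ▸ piece (d9), brick J2-5: THE DISPLACEMENT OF A RETURN MAP AS A RECTANGLE WINDING NUMBER
(wave 8, crux stmt-SmoothPoincare4-10508, line `modp-braid-orbits`, registered stub `stub_M2geo` (N1) ▸
`node_N1_move` ▸ sub-node (d) `helper_N1_beltMonodromy` ▸ piece (d9); registered sub-goal
`helper_returnMap_rectangleWinding`; independent of bricks J2-1…4)

The bookkeeping that reduces piece (d9) for the TRUE model to a winding number (J2-REPORT §3, Route B′).  In the (d) statement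
the return map is a lift `G : ℝ × ℝ → ℝ × ℝ` with `G = id` for `r ≤ -1/2` and `G (u, r) = (u + n₀, r)` for `r ≥ 1/2`, and the
two-sided belt chart `Λ` reads, through the Kosinski gluing, the fibre DIRECTION of the belt coordinate `m` of its points as the
base core angle of the chart point: `e^{2πi (u' + L (u', r', σ))}` for a continuous `1`-periodic-in-`u'` phase `L` (the lift
of the core angle of the input chart family `φ`) — with the chart coordinates `(u', r')` themselves BELOW the belt page angle and
on the SIDES, and twisted by `G` ABOVE.  Going once around the boundary of the rectangle `{u' = 0} × [-1/2, 1/2] × [-a, a]`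
(bottom left → right, right side up, top right → left, left side down) the fibre direction therefore winds **`-n₀`** times
(`helper_returnMap_rectangleWinding`): the phases of the four edges glue to ONE continuous phase dropping by `n₀`.  The loop
bounds the flow rectangle of the transversal field, so `-n₀` is decided where that rectangle crosses the belt circle — on the
linear model by `helper_linearBeltReturn_integer` (brick J2-2).  Everything is proved; no named facts, no `sorry`.
Reference: R. E. Gompf, A. I. Stipsicz, *4-Manifolds and Kirby Calculus* (1999), §8.2 [GompfStipsicz1999]; W. Fulton,
*Algebraic Topology: A First Course* (1995), §3 [Fulton1995].
-/

noncomputable section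

set_option linter.dupNamespace false

open Set Function Complex Filter
open Literature.Topology.PlaneTopology

namespace Summit.SmoothPoincare4.SmoothPoincare4.Theorems.AcyclicBisectionExists.ModpBraidOrbits

/-- A `1`-periodic function is invariant under integer shifts. [folklore] -/
theorem apply_add_int_of_periodic {g : ℝ → ℝ} (h : ∀ u : ℝ, g (u + 1) = g u) (n : ℤ) (u : ℝ) : g (u + n) = g u := by
  have hp : Function.Periodic g 1 := h
  have := hp.int_mul n u
  simpa using this

/-- `e^{2πi (x - n)} = e^{2πi x}` for an integer `n`. [folklore] -/
theorem exp_two_pi_I_sub_int (x : ℝ) (n : ℤ) :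
    Complex.exp (2 * Real.pi * I * ((x - n : ℝ) : ℂ)) = Complex.exp (2 * Real.pi * I * (x : ℂ)) := by
  have e : 2 * Real.pi * I * ((x - n : ℝ) : ℂ) = 2 * Real.pi * I * (x : ℂ) - (n : ℂ) * (2 * Real.pi * I) := by
    push_cast; ring
  rw [e, Complex.exp_sub, Complex.exp_int_mul_two_pi_mul_I, div_one]

/-- **THE DISPLACEMENT OF A RETURN MAP IS MINUS THE WINDING NUMBER OF THE FIBRE DIRECTION AROUND THE RECTANGLE**
(piece (d9), the reduction to a winding number).  `G` = the return map of the (d) statement (`= id` for `r ≤ -1/2`,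
`= (u + n₀, r)` for `r ≥ 1/2`), `L` = a continuous `1`-periodic-in-`u'` phase (lift of the core angle of the chart family),
`f (r', σ)` = the fibre direction (as a unit complex number) of the belt coordinate of `Λ (0, r', σ)`: on the bottom `σ = -a`
and the sides `|r'| = 1/2` it is `e^{2πi L (0, r', σ)}`, on the top `σ = a` it is `e^{2πi (G₁ + L (G (0, r'), a))}`.  Then
the loop `f ∘ ∂([-1/2, 1/2] × [-a, a])` (counterclockwise, four quarter-time edges from the bottom-left corner) winds `-n₀`
times. [cite: GompfStipsicz1999, §8.2] -/
theorem helper_returnMap_rectangleWinding : ∀ (G : ℝ × ℝ → ℝ × ℝ) (n₀ : ℤ) (L : ℝ × ℝ × ℝ → ℝ) (a : ℝ) (f : ℝ × ℝ → ℂ), 0 < a → Continuous G → (∀ u r : ℝ, r ≤ -(1 / 2 : ℝ) → G (u, r) = (u, r)) → (∀ u r : ℝ, (1 / 2 : ℝ) ≤ r → G (u, r) = (u + n₀, r)) → Continuous L → (∀ u r σ : ℝ, L (u + 1, r, σ) = L (u, r, σ)) → (∀ r σ : ℝ, r ∈ Set.Icc (-(1 / 2 : ℝ)) (1 / 2) →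 σ ∈ Set.Icc (-a) a → (σ = -a ∨ |r| = 1 / 2) → f (r, σ) = Complex.exp (2 * Real.pi * Complex.I * (L (0, r, σ) : ℂ))) → (∀ r : ℝ, r ∈ Set.Icc (-(1 / 2 : ℝ)) (1 / 2) → f (r, a) = Complex.exp (2 * Real.pi * Complex.I * (((G (0, r)).1 + L ((G (0, r)).1, (G (0, r)).2, a) : ℝ) : ℂ))) → Literature.Topology.PlaneTopology.wind (fun s : ℝ => f (if s ≤ 1 / 4 then (-(1 / 2 : ℝ) + 4 * s, -a) else if s ≤ 1 / 2 then ((1 / 2 : ℝ), -a + 8 * a * (s - 1 / 4)) else if s ≤ 3 / 4 then ((1 / 2 : ℝ) - 4 * (s - 1 / 2), a) else (-(1 / 2 : ℝ), a - 8 * a * (s - 3 / 4)))) = -n₀ := by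
  intro G n₀ L a f ha hG hGlo hGhi hL hLper hbs htop
  -- the values of `G` at the two sides and the integer periodicity of `L`
  have hGhalf : G (0, 1 / 2) = ((n₀ : ℝ), 1 / 2) := by
    have h := hGhi 0 (1 / 2) le_rfl
    rw [zero_add] at h
    exact h
  have hGneg : G (0, -(1 / 2)) = (0, -(1 / 2)) := hGlo 0 (-(1 / 2)) le_rfl
  have hLn : ∀ r σ : ℝ, L ((n₀ : ℝ), r, σ) = L (0, r, σ) := fun r σ => by
    have h := apply_add_int_of_periodic (g := fun u => L (u, r, σ)) (fun u => hLper u r σ) n₀ 0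
    simpa using h
  -- the four phases and their gluing
  set Φ₁ : ℝ → ℝ := fun s => L (0, -(1 / 2) + 4 * s, -a) with hΦ₁
  set Φ₂ : ℝ → ℝ := fun s => L (0, 1 / 2, -a + 8 * a * (s - 1 / 4)) with hΦ₂
  set Φ₃ : ℝ → ℝ := fun s => (G (0, 1 / 2 - 4 * (s - 1 / 2))).1 +
    L ((G (0, 1 / 2 - 4 * (s - 1 / 2))).1, (G (0, 1 / 2 - 4 * (s - 1 / 2))).2, a) - n₀ with hΦ₃
  set Φ₄ : ℝ → ℝ := fun s => L (0, -(1 / 2), a - 8 * a * (s - 3 / 4)) - n₀ with hΦ₄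
  have c1 : Continuous Φ₁ := hL.comp (by fun_prop)
  have c2 : Continuous Φ₂ := hL.comp (by fun_prop)
  have hG' : Continuous fun s : ℝ => G (0, 1 / 2 - 4 * (s - 1 / 2)) := hG.comp (by fun_prop)
  have c3 : Continuous Φ₃ := by
    refine ((continuous_fst.comp hG').add (hL.comp ?_)).sub continuous_const
    exact (continuous_fst.comp hG').prodMk ((continuous_snd.comp hG').prodMk continuous_const)
  have c4 : Continuous Φ₄ := (hL.comp (by fun_prop)).sub continuous_const
  have j12 : Φ₁ (1 / 4) = Φ₂ (1 / 4) := by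
    simp only [hΦ₁, hΦ₂]; norm_num
  have j23 : Φ₂ (1 / 2) = Φ₃ (1 / 2) := by
    have e1 : -a + 8 * a * (1 / 2 - 1 / 4 : ℝ) = a := by ring
    have e2 : (1 / 2 : ℝ) - 4 * (1 / 2 - 1 / 2) = 1 / 2 := by norm_num
    simp only [hΦ₂, hΦ₃]
    rw [e1, e2, hGhalf]
    dsimp only
    rw [hLn]
    ring
  have j34 : Φ₃ (3 / 4) = Φ₄ (3 / 4) := by
    simp only [hΦ₃, hΦ₄]
    norm_num
    rw [hGneg]
    simp
  set Φ : ℝ → ℝ := fun s => if s ≤ 1 / 4 then Φ₁ s else if s ≤ 1 / 2 then Φ₂ s else if s ≤ 3 / 4 then Φ₃ s else Φ₄ s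
    with hΦ
  have c34 : Continuous fun s : ℝ => if s ≤ 3 / 4 then Φ₃ s else Φ₄ s :=
    c3.if_le c4 continuous_id continuous_const (fun x hx => by rw [hx]; exact j34)
  have c234 : Continuous fun s : ℝ => if s ≤ 1 / 2 then Φ₂ s else if s ≤ 3 / 4 then Φ₃ s else Φ₄ s :=
    c2.if_le c34 continuous_id continuous_const (fun x hx => by
      rw [hx, if_pos (by norm_num : (1 / 2 : ℝ) ≤ 3 / 4)]; exact j23)
  have cΦ : Continuous Φ :=
    c1.if_le c234 continuous_id continuous_const (fun x hx => by
      rw [hx, if_pos (by norm_num : (1 / 4 : ℝ) ≤ 1 / 2)]; exact j12)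
  -- the loop is `e^{2πi Φ}` on `[0, 1]`
  have key : ∀ s ∈ Icc (0 : ℝ) 1, Complex.exp (2 * Real.pi * I * (Φ s : ℂ)) =
      f (if s ≤ 1 / 4 then (-(1 / 2 : ℝ) + 4 * s, -a) else if s ≤ 1 / 2 then ((1 / 2 : ℝ), -a + 8 * a * (s - 1 / 4))
        else if s ≤ 3 / 4 then ((1 / 2 : ℝ) - 4 * (s - 1 / 2), a) else (-(1 / 2 : ℝ), a - 8 * a * (s - 3 / 4))) := by
    intro s hs
    simp only [hΦ]
    split_ifs with h1 h2 h3
    · rw [hbs _ _ ⟨by linarith [hs.1], by linarith⟩ ⟨le_rfl, by linarith⟩ (Or.inl rfl)]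
    · have hs1 : 1 / 4 < s := lt_of_not_ge h1
      rw [hbs _ _ ⟨by norm_num, le_rfl⟩ ⟨by nlinarith, by nlinarith⟩ (Or.inr (by norm_num [abs_of_pos]))]
    · have hs2 : 1 / 2 < s := lt_of_not_ge h2
      rw [htop _ ⟨by linarith, by linarith⟩, hΦ₃]
      exact exp_two_pi_I_sub_int _ _
    · have hs3 : 3 / 4 < s := lt_of_not_ge h3
      rw [hbs _ _ ⟨le_rfl, by norm_num⟩ ⟨by nlinarith [hs.2], by nlinarith [hs.2]⟩
        (Or.inr (by norm_num [abs_of_neg])), hΦ₄]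
      exact exp_two_pi_I_sub_int _ _
  have h01 : f (if (0 : ℝ) ≤ 1 / 4 then (-(1 / 2 : ℝ) + 4 * 0, -a) else if (0 : ℝ) ≤ 1 / 2 then
        ((1 / 2 : ℝ), -a + 8 * a * (0 - 1 / 4)) else if (0 : ℝ) ≤ 3 / 4 then ((1 / 2 : ℝ) - 4 * (0 - 1 / 2), a)
        else (-(1 / 2 : ℝ), a - 8 * a * (0 - 3 / 4))) =
      f (if (1 : ℝ) ≤ 1 / 4 then (-(1 / 2 : ℝ) + 4 * 1, -a) else if (1 : ℝ) ≤ 1 / 2 then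
        ((1 / 2 : ℝ), -a + 8 * a * (1 - 1 / 4)) else if (1 : ℝ) ≤ 3 / 4 then ((1 / 2 : ℝ) - 4 * (1 - 1 / 2), a)
        else (-(1 / 2 : ℝ), a - 8 * a * (1 - 3 / 4))) := by
    rw [if_pos (by norm_num), if_neg (by norm_num), if_neg (by norm_num), if_neg (by norm_num)]
    congr 1
    refine Prod.ext (by norm_num) ?_
    show -a = a - 8 * a * (1 - 3 / 4)
    ring
  have hws := wind_spec (l := fun s => 2 * Real.pi * I * (Φ s : ℂ))
    ((continuous_const.mul (continuous_ofReal.comp cΦ)).continuousOn) key h01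
  have hΦ0 : Φ 0 = L (0, -(1 / 2), -a) := by
    simp only [hΦ, hΦ₁]; rw [if_pos (by norm_num)]; norm_num
  have hΦ1' : Φ 1 = L (0, -(1 / 2), -a) - n₀ := by
    have e4 : a - 8 * a * (1 - 3 / 4 : ℝ) = -a := by ring
    simp only [hΦ, hΦ₄]; rw [if_neg (by norm_num), if_neg (by norm_num), if_neg (by norm_num), e4]
  apply int_eq_of_mul_two_pi_I_eq
  rw [← hws, hΦ1', hΦ0]
  push_cast
  ring

end Summit.SmoothPoincare4.SmoothPoincare4.Theorems.AcyclicBisectionExists.ModpBraidOrbits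

end
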